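import Mathlib
import Literature.RepresentationTheory.FiniteGroups.KLRGradedCellularBasis
import Summits.MatrixMultiplication.MatrixMultiplication.Theorems.SnSubsetDichotomyNoThresholdSubsetTripleStubCoreLeDurfee
import Summits.MatrixMultiplication.MatrixMultiplication.Theorems.SnSubsetDichotomyNoThresholdSubsetTripleStubDurfeeShape
import Summits.MatrixMultiplication.MatrixMultiplication.Theorems.SnSubsetDichotomyNoThresholdSubsetTripleStubShapeTailCount
import Summits.MatrixMultiplication.MatrixMultiplication.Theorems.SnSubsetDichotomyNoThresholdSubsetTripleFirstRowTail

/-!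
# `SnSubsetDichotomy.NoThresholdSubsetTriple`, line `klr-graded-polynomial-method`:
# stub `smallWeightTail` (Plancherel count of the small-`2`-weight shapes)

For a partition `μ ⊢ n` let `cᵢ = residueContent 2 μ i` be the number of cells of `2`-residue
`i` and `w(μ) = c₀ − (c₀ − c₁)²` its `2`-block weight. The same-shape pairs of standard tableaux
`(μ, S, T)` with `32·w(μ) < n` (the `2`-core fills more than `15/16` of the shape: a
near-staircase) number at most `n!·e^{-c√n}` for some `c > 0` and all large `n`.

Proof (all inputs are tree theorems):
* `32w < n` and `c₀ + c₁ = n` give, with `ξ = c₀ − c₁` and the Durfee number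
  `d = #{j < n : (j, j) ∈ μ}`, `15n < 16·ξ(2ξ − 1) ≤ 16·d(2d + 1)` (`stub_core_le_durfee`), hence
  `d ≥ (27/40)√n` once `√n ≥ 26`;
* a large-Durfee pair has a first row `≥ 3√n`, or a first column `≥ 3√n`, or lies in the
  `3√n`-box; the first kind is counted by `firstRowTail` (`≤ n!e^{-c_R√n}`), the second is
  injected into the first by the transpose map `(μ, S, T) ↦ (μᵗ, Sᵗ, Tᵗ)` on `TableauPair n`,
  and the boxed kind is counted by `stub_durfeeShape` + `stub_shapeTailCount` (`≤ n!e^{-c_B n}`);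
* `2·n!e^{-c√n} + n!e^{-c√n} = 3·n!e^{-c√n} ≤ n!e^{-(c/2)√n}` for `c = min c_B c_R` and
  `e^{(c/2)√n} ≥ 3`.

The transpose map, its injectivity, the invariance of the `2`-content under transposition and
the column-tail count are exposed in the sub-namespace `KlrLine` for the later files of the line.
-/

namespace Summit.MatrixMultiplication.MatrixMultiplication.Theorems

open Literature.RepresentationTheory.FiniteGroups (TableauPair residueContent cellResidue tableauDegree)
open Literature.NumberTheory.DiophantineGeometry (StdFilling)

namespace KlrLine

/-! ### The transpose map on `TableauPair n` -/

/-- A partition is determined by its Young diagram. [folklore] -/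
private theorem partition_eq_of_youngDiagram_eq {n : ℕ} {μ ν : Nat.Partition n}
    (h : μ.youngDiagram = ν.youngDiagram) : μ = ν := by
  ext1
  rw [← Multiset.sort_eq μ.parts (· ≥ ·), ← Multiset.sort_eq ν.parts (· ≥ ·)]
  change (μ.sortedParts : Multiset ℕ) = ν.sortedParts
  rw [← μ.rowLens_youngDiagram, ← ν.rowLens_youngDiagram, h]

/-- The shape of a standard tableau is the set of its cells. [folklore] -/
private theorem mem_youngDiagram_iff_exists {n : ℕ} (μ : Nat.Partition n)
    (T : StdFilling n μ.youngDiagram) (x : ℕ × ℕ) :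
    x ∈ μ.youngDiagram ↔ ∃ p, T.1 p = x :=
  ⟨fun hx => T.exists_eq μ.card_cells_youngDiagram hx, fun ⟨p, hp⟩ => hp ▸ T.mem p⟩

/-- A same-shape pair is determined by its two raw growth sequences. [folklore] -/
private theorem tableauPair_eq_of_val_eq {n : ℕ} {i j : TableauPair n} (h₁ : i.2.1.1 = j.2.1.1)
    (h₂ : i.2.2.1 = j.2.2.1) : i = j := by
  obtain ⟨μ, S, T⟩ := i
  obtain ⟨ν, S', T'⟩ := j
  dsimp only at h₁ h₂
  have hμν : μ = ν := by
    refine partition_eq_of_youngDiagram_eq (YoungDiagram.ext (Finset.ext fun x => ?_))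
    rw [YoungDiagram.mem_cells, YoungDiagram.mem_cells, mem_youngDiagram_iff_exists μ S,
      mem_youngDiagram_iff_exists ν S', h₁]
  subst hμν
  have hS : S = S' := Subtype.ext h₁
  have hT : T = T' := Subtype.ext h₂
  subst hS
  subst hT
  rfl

set_option linter.dupNamespace false in -- deliberate Summit.<S>.<P> duplicate
/-- **The transpose map `(μ, S, T) ↦ (μᵗ, Sᵗ, Tᵗ)` on same-shape pairs of standard tableaux**:
an injective self-map of `TableauPair n` replacing the shape by its transpose and both growth
sequences by their coordinate swaps (a standard tableau of shape `μ` transposes to a standard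
tableau of shape `μᵗ`: membership by `YoungDiagram.mem_transpose`, monotonicity by
`Prod.swap_le_swap`). [folklore] -/
theorem exists_transposePair : ∀ n, ∃ τ : TableauPair n → TableauPair n, Function.Injective τ ∧ ∀ i, (τ i).1 = i.1.transpose ∧ (τ i).2.1.1 = Prod.swap ∘ i.2.1.1 ∧ (τ i).2.2.1 = Prod.swap ∘ i.2.2.1 := by
  intro n
  have hT : ∀ (μ : Nat.Partition n) (T : StdFilling n μ.youngDiagram),
      Literature.NumberTheory.DiophantineGeometry.IsStdFilling n μ.transpose.youngDiagram
        (Prod.swap ∘ T.1) := fun μ T => by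
    refine ⟨fun p => ?_, Prod.swap_injective.comp T.injective, fun p q hpq hle => T.not_le hpq ?_⟩
    · rw [Nat.Partition.youngDiagram_transpose, ← YoungDiagram.mem_cells]
      show Prod.swap (T.1 p) ∈ μ.youngDiagram.transpose.cells
      rw [YoungDiagram.mem_cells, YoungDiagram.mem_transpose, Prod.swap_swap]
      exact T.mem p
    · exact Prod.swap_le_swap.1 hle
  refine ⟨fun i => ⟨i.1.transpose, ⟨Prod.swap ∘ i.2.1.1, hT i.1 i.2.1⟩,
    ⟨Prod.swap ∘ i.2.2.1, hT i.1 i.2.2⟩⟩, fun i j h => ?_, fun i => ⟨rfl, rfl, rfl⟩⟩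
  have h₁ := congrArg (fun k : TableauPair n => k.2.1.1) h
  have h₂ := congrArg (fun k : TableauPair n => k.2.2.1) h
  dsimp only at h₁ h₂
  refine tableauPair_eq_of_val_eq (funext fun p => ?_) (funext fun p => ?_)
  · simpa using congrFun h₁ p
  · simpa using congrFun h₂ p

/-- Transposition preserves `2`-residues: `res₂ (c, r) = r − c = c − r = res₂ (r, c)` in
`ZMod 2`. [folklore] -/
private theorem cellResidue_two_swap (x : ℕ × ℕ) : cellResidue 2 x.swap = cellResidue 2 x := by
  unfold cellResidue
  rw [Prod.fst_swap, Prod.snd_swap, ← ZMod.neg_eq_self_mod_two ((x.2 : ZMod 2) - x.1), neg_sub]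

set_option linter.dupNamespace false in -- deliberate Summit.<S>.<P> duplicate
/-- **Transposition preserves the `2`-content** (`p = 2` only: `−1 = 1`). [folklore] -/
theorem residueContent_transpose : ∀ n (μ : Nat.Partition n) (j : ZMod 2), residueContent 2 μ.transpose j = residueContent 2 μ j := by
  intro n μ j
  unfold residueContent
  rw [Nat.Partition.youngDiagram_transpose]
  change (((Equiv.prodComm ℕ ℕ).finsetCongr μ.youngDiagram.cells).filter
    fun c => cellResidue 2 c = j).card = _
  rw [Equiv.finsetCongr_apply, Finset.filter_map, Finset.card_map]
  congr 1
  refine Finset.filter_congr fun x _ => ?_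
  show cellResidue 2 (Equiv.prodComm ℕ ℕ x) = j ↔ cellResidue 2 x = j
  rw [Equiv.prodComm_apply, cellResidue_two_swap]

set_option linter.dupNamespace false in -- deliberate Summit.<S>.<P> duplicate
/-- **The two `2`-residue classes partition the cells: `c₀ + c₁ = n`.** [folklore] -/
theorem residueContent_two_add : ∀ n (μ : Nat.Partition n), residueContent 2 μ 0 + residueContent 2 μ 1 = n := by
  intro n μ
  classical
  unfold residueContent
  rw [← Finset.card_union_of_disjoint (Finset.disjoint_filter.2 fun x _ h0 h1 => by
    rw [h0] at h1; exact absurd h1 (by decide))]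
  have hz : ∀ z : ZMod 2, z = 0 ∨ z = 1 := by decide
  rw [← Finset.filter_or, Finset.filter_true_of_mem fun x _ => hz (cellResidue 2 x),
    μ.card_cells_youngDiagram]

set_option linter.dupNamespace false in -- deliberate Summit.<S>.<P> duplicate
/-- **The first-column tail is at most the first-row tail**: the transpose map injects the pairs
whose shape has first column `≥ 3√n` into those whose shape has first row `≥ 3√n`
(`YoungDiagram.rowLen_transpose`). [folklore] -/
theorem card_colTail_le : ∀ n, Nat.card {i : TableauPair n // 3 * Real.sqrt (n : ℝ) ≤ (i.1.youngDiagram.colLen 0 : ℝ)} ≤ Nat.card {i : TableauPair n // 3 * Real.sqrt (n : ℝ) ≤ (i.1.youngDiagram.rowLen 0 : ℝ)} := by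
  intro n
  classical
  haveI : Fintype (TableauPair n) := Fintype.ofFinite _
  obtain ⟨τ, hτ, hτ'⟩ := exists_transposePair n
  have hrow : ∀ i : TableauPair n, (τ i).1.youngDiagram.rowLen 0 = i.1.youngDiagram.colLen 0 :=
    fun i => by
      rw [(hτ' i).1, Nat.Partition.youngDiagram_transpose, YoungDiagram.rowLen_transpose]
  simp only [Nat.card_eq_fintype_card]
  refine Fintype.card_le_of_injective (fun i => ⟨τ i.1, by rw [hrow]; exact i.2⟩) fun i j h => ?_
  exact Subtype.ext (hτ (congrArg Subtype.val h))

/-! ### Constants -/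

set_option linter.dupNamespace false in -- deliberate Summit.<S>.<P> duplicate
/-- Beyond some `n₁`, `3 ≤ e^{(c/2)√n}`. [folklore] -/
theorem exists_three_le_exp {c : ℝ} (hc : 0 < c) :
    ∃ n₁ : ℕ, ∀ n : ℕ, n₁ ≤ n → (3 : ℝ) ≤ Real.exp (c / 2 * Real.sqrt (n : ℝ)) := by
  refine ⟨⌈(2 * Real.log 3 / c) ^ 2⌉₊, fun n hn => ?_⟩
  have hn' : (2 * Real.log 3 / c) ^ 2 ≤ (n : ℝ) := (Nat.le_ceil _).trans (by exact_mod_cast hn)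
  have h0 : 0 ≤ 2 * Real.log 3 / c := by
    have : 0 ≤ Real.log 3 := Real.log_nonneg (by norm_num)
    positivity
  have hsq : 2 * Real.log 3 / c ≤ Real.sqrt (n : ℝ) := by
    rw [← Real.sqrt_sq h0]
    exact Real.sqrt_le_sqrt hn'
  have hlog : Real.log 3 ≤ c / 2 * Real.sqrt (n : ℝ) := by
    have := mul_le_mul_of_nonneg_left hsq (le_of_lt (half_pos hc))
    calc Real.log 3 = c / 2 * (2 * Real.log 3 / c) := by field_simp
      _ ≤ c / 2 * Real.sqrt (n : ℝ) := this
  calc (3 : ℝ) = Real.exp (Real.log 3) := (Real.exp_log (by norm_num)).symm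
    _ ≤ Real.exp (c / 2 * Real.sqrt (n : ℝ)) := Real.exp_le_exp.2 hlog

set_option linter.dupNamespace false in -- deliberate Summit.<S>.<P> duplicate
/-- `n ≥ M²` gives `M ≤ √n`. [folklore] -/
theorem le_sqrt_of_sq_le {M : ℝ} (hM : 0 ≤ M) {n : ℕ} (h : M ^ 2 ≤ (n : ℝ)) :
    M ≤ Real.sqrt (n : ℝ) := by
  rw [← Real.sqrt_sq hM]
  exact Real.sqrt_le_sqrt h

/-! ### The near-staircase regime is inside the Durfee tail -/

/-- From `stub_core_le_durfee`: a near-staircase shape (`32w < n`) has a large Durfee square,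
`d ≥ (27/40)√n`, once `√n ≥ 26` (`15n < 16·d(2d+1)` and `16·(27/40)√n·((27/20)√n + 1) ≤ 15n`).
[folklore] -/
private theorem durfeeLarge_of_smallWeight {n : ℕ} (hn : (26 : ℝ) ≤ Real.sqrt (n : ℝ))
    {i : TableauPair n}
    (hi : 32 * ((TableauPair.content 2 i 0 : ℤ) -
      ((TableauPair.content 2 i 0 : ℤ) - (TableauPair.content 2 i 1 : ℤ)) ^ 2) < (n : ℤ)) :
    (27 : ℝ) / 40 * Real.sqrt (n : ℝ) ≤
      (((Finset.range n).filter (fun j : ℕ => (j, j) ∈ i.1.youngDiagram)).card : ℝ) := by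
  have hc := stub_core_le_durfee n i.1
  have hsum : (residueContent 2 i.1 0 : ℤ) + (residueContent 2 i.1 1 : ℤ) = n := by
    exact_mod_cast residueContent_two_add n i.1
  unfold TableauPair.content at hi
  set c0 : ℤ := (residueContent 2 i.1 0 : ℤ) with hc0
  set c1 : ℤ := (residueContent 2 i.1 1 : ℤ) with hc1
  set d : ℕ := ((Finset.range n).filter (fun j : ℕ => (j, j) ∈ i.1.youngDiagram)).card with hd
  -- integer consequence: `15 n < 16 d (2d+1)`
  have hkey : 15 * (n : ℤ) < 16 * ((d : ℤ) * (2 * (d : ℤ) + 1)) := by nlinarith [hc, hi, hsum]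
  have hkeyR : 15 * (n : ℝ) < 16 * ((d : ℝ) * (2 * (d : ℝ) + 1)) := by exact_mod_cast hkey
  have hn0 : (0 : ℝ) ≤ n := Nat.cast_nonneg n
  have hsq : Real.sqrt (n : ℝ) ^ 2 = n := Real.sq_sqrt hn0
  have hd0 : (0 : ℝ) ≤ d := Nat.cast_nonneg d
  by_contra hlt
  push Not at hlt
  -- `d < 0.675 √n` gives `16 d(2d+1) < 16·0.675√n (1.35√n + 1) ≤ 15 n` once `√n ≥ 26`
  nlinarith [hlt, hkeyR, hsq, hn, hd0, Real.sqrt_nonneg (n : ℝ)]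

/-- Counting: `#{32w < n} ≤ #{d ≥ (27/40)√n}` for `√n ≥ 26`. [folklore] -/
private theorem card_smallWeight_le {n : ℕ} (hn : (26 : ℝ) ≤ Real.sqrt (n : ℝ)) :
    Nat.card {i : TableauPair n // 32 * ((TableauPair.content 2 i 0 : ℤ) -
        ((TableauPair.content 2 i 0 : ℤ) - (TableauPair.content 2 i 1 : ℤ)) ^ 2) < (n : ℤ)} ≤
      Nat.card {i : TableauPair n // (27 : ℝ) / 40 * Real.sqrt (n : ℝ) ≤
        (((Finset.range n).filter (fun j : ℕ => (j, j) ∈ i.1.youngDiagram)).card : ℝ)} := by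
  classical
  haveI : Fintype (TableauPair n) := Fintype.ofFinite _
  simp only [Nat.card_eq_fintype_card]
  exact Fintype.card_subtype_mono _ _ fun i hi => durfeeLarge_of_smallWeight hn hi

/-- Counting: `#{d ≥ (27/40)√n} ≤ 2·#{λ₁ ≥ 3√n} + #{λ₁ < 3√n ∧ ℓ < 3√n ∧ d ≥ (27/40)√n}` — a
large-Durfee pair has a long first row, or a long first column (transpose injection
`card_colTail_le`), or lies in the `3√n`-box. [folklore] -/
private theorem card_durfeeLarge_le (n : ℕ) :
    Nat.card {i : TableauPair n // (27 : ℝ) / 40 * Real.sqrt (n : ℝ) ≤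
        (((Finset.range n).filter (fun j : ℕ => (j, j) ∈ i.1.youngDiagram)).card : ℝ)} ≤
      2 * Nat.card {i : TableauPair n // 3 * Real.sqrt (n : ℝ) ≤ (i.1.youngDiagram.rowLen 0 : ℝ)} +
        Nat.card {i : TableauPair n //
          (i.1.youngDiagram.rowLen 0 : ℝ) < 3 * Real.sqrt (n : ℝ) ∧
            (i.1.youngDiagram.colLen 0 : ℝ) < 3 * Real.sqrt (n : ℝ) ∧
              (27 : ℝ) / 40 * Real.sqrt (n : ℝ) ≤
                (((Finset.range n).filter (fun j : ℕ => (j, j) ∈ i.1.youngDiagram)).card : ℝ)} := by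
  classical
  haveI : Fintype (TableauPair n) := Fintype.ofFinite _
  have hcol := card_colTail_le n
  simp only [Nat.card_eq_fintype_card] at hcol ⊢
  -- abbreviations for the three events, as predicates
  set R : TableauPair n → Prop := fun i => 3 * Real.sqrt (n : ℝ) ≤ (i.1.youngDiagram.rowLen 0 : ℝ)
    with hR
  set C : TableauPair n → Prop := fun i => 3 * Real.sqrt (n : ℝ) ≤ (i.1.youngDiagram.colLen 0 : ℝ)
    with hC
  set D : TableauPair n → Prop := fun i => (27 : ℝ) / 40 * Real.sqrt (n : ℝ) ≤
      (((Finset.range n).filter (fun j : ℕ => (j, j) ∈ i.1.youngDiagram)).card : ℝ) with hD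
  set B : TableauPair n → Prop := fun i => (i.1.youngDiagram.rowLen 0 : ℝ) < 3 * Real.sqrt (n : ℝ) ∧
      (i.1.youngDiagram.colLen 0 : ℝ) < 3 * Real.sqrt (n : ℝ) ∧
        (27 : ℝ) / 40 * Real.sqrt (n : ℝ) ≤
          (((Finset.range n).filter (fun j : ℕ => (j, j) ∈ i.1.youngDiagram)).card : ℝ) with hB
  change Fintype.card {i // C i} ≤ Fintype.card {i // R i} at hcol
  show Fintype.card {i // D i} ≤ 2 * Fintype.card {i // R i} + Fintype.card {i // B i}
  have hcases : ∀ i, D i → R i ∨ (C i ∨ B i) := fun i h => by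
    by_cases hr : R i
    · exact Or.inl hr
    by_cases hc : C i
    · exact Or.inr (Or.inl hc)
    exact Or.inr (Or.inr ⟨lt_of_not_ge hr, lt_of_not_ge hc, h⟩)
  have h1 : Fintype.card {i // D i} ≤ Fintype.card {i // R i ∨ (C i ∨ B i)} :=
    Fintype.card_subtype_mono _ _ hcases
  have h2 : Fintype.card {i // R i ∨ (C i ∨ B i)} ≤
      Fintype.card {i // R i} + Fintype.card {i // C i ∨ B i} :=
    Fintype.card_subtype_or _ _
  have h3 : Fintype.card {i // C i ∨ B i} ≤ Fintype.card {i // C i} + Fintype.card {i // B i} :=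
    Fintype.card_subtype_or _ _
  omega

/-- **The boxed Durfee tail, count form** (`stub_shapeTailCount` applied to `stub_durfeeShape`):
the same-shape pairs whose shape lies in the `3√n`-box and has `d ≥ (27/40)√n` number at most
`n!·e^{-cn}` for large `n`. [folklore] -/
private theorem durfeeTailBox :
    ∃ c : ℝ, 0 < c ∧ ∃ n₀ : ℕ, ∀ n ≥ n₀,
      (Nat.card {i : TableauPair n //
          (i.1.youngDiagram.rowLen 0 : ℝ) < 3 * Real.sqrt (n : ℝ) ∧
            (i.1.youngDiagram.colLen 0 : ℝ) < 3 * Real.sqrt (n : ℝ) ∧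
              (27 : ℝ) / 40 * Real.sqrt (n : ℝ) ≤
                (((Finset.range n).filter (fun j : ℕ => (j, j) ∈ i.1.youngDiagram)).card : ℝ)} : ℝ) ≤
        (n.factorial : ℝ) * Real.exp (-(c * (n : ℝ))) := by
  obtain ⟨κ, hκ, n₁, h⟩ := stub_durfeeShape
  exact stub_shapeTailCount
    (fun n μ => (μ.youngDiagram.rowLen 0 : ℝ) < 3 * Real.sqrt (n : ℝ) ∧
      (μ.youngDiagram.colLen 0 : ℝ) < 3 * Real.sqrt (n : ℝ) ∧
        (27 : ℝ) / 40 * Real.sqrt (n : ℝ) ≤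
          (((Finset.range n).filter (fun j : ℕ => (j, j) ∈ μ.youngDiagram)).card : ℝ))
    κ hκ ⟨n₁, fun n hn μ hμ => h n hn μ hμ.1 hμ.2.1 hμ.2.2⟩

end KlrLine

set_option linter.dupNamespace false in -- deliberate Summit.<S>.<P> duplicate
open KlrLine in
/-- **Stub `smallWeightTail` (line `klr-graded-polynomial-method`, crux
`SnSubsetDichotomy.NoThresholdSubsetTriple`, stmt-MatrixMultiplication-8302): the near-staircase
regime has Plancherel mass `≤ n!e^{-c√n}`.** With `cᵢ = residueContent 2 μ i` and the `2`-block
weight `w = c₀ − (c₀ − c₁)²`, the same-shape pairs of standard tableaux `(μ, S, T)` with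
`32w < n` number at most `n!·e^{-c√n}` for some `c > 0` and all large `n`:
`#{32w < n} ≤ #{d ≥ (27/40)√n}` (`stub_core_le_durfee`, `√n ≥ 26`)
`≤ 2·#{λ₁ ≥ 3√n} + #{box ∧ d ≥ (27/40)√n}` (transpose injection)
`≤ 2·n!e^{-c√n} + n!e^{-cn} ≤ 3·n!e^{-c√n} ≤ n!e^{-(c/2)√n}` (`firstRowTail`, `stub_durfeeShape`,
`stub_shapeTailCount`). [folklore] -/
theorem smallWeightTail : ∃ c : ℝ, 0 < c ∧ ∃ n₀ : ℕ, ∀ n ≥ n₀, (Nat.card {i : TableauPair n // 32 * ((TableauPair.content 2 i 0 : ℤ) - ((TableauPair.content 2 i 0 : ℤ) - (TableauPair.content 2 i 1 : ℤ)) ^ 2) < (n : ℤ)} : ℝ) ≤ (n.factorial : ℝ) * Real.exp (-(c * Real.sqrt (n : ℝ))) := by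
  obtain ⟨cB, hcB, nB, hB⟩ := durfeeTailBox
  obtain ⟨cR, hcR, nR, hR⟩ := firstRowTail
  set c := min cB cR with hcdef
  have hc : 0 < c := lt_min hcB hcR
  obtain ⟨n₁, hn₁⟩ := exists_three_le_exp hc
  refine ⟨c / 2, half_pos hc, max (max (max nB nR) n₁) (26 ^ 2), fun n hn => ?_⟩
  have hnB : nB ≤ n := (((le_max_left _ _).trans (le_max_left _ _)).trans (le_max_left _ _)).trans hn
  have hnR : nR ≤ n := (((le_max_right _ _).trans (le_max_left _ _)).trans (le_max_left _ _)).trans hn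
  have h3 := hn₁ n (((le_max_right _ _).trans (le_max_left _ _)).trans hn)
  have h26sq : ((26 : ℕ) ^ 2 : ℕ) ≤ n := (le_max_right _ _).trans hn
  have h26 : (26 : ℝ) ≤ Real.sqrt (n : ℝ) :=
    le_sqrt_of_sq_le (by norm_num) (by exact_mod_cast h26sq)
  have hcount := (card_smallWeight_le (n := n) h26).trans (card_durfeeLarge_le n)
  -- abbreviations for the three counts
  set W := Nat.card {i : TableauPair n // 32 * ((TableauPair.content 2 i 0 : ℤ) -
      ((TableauPair.content 2 i 0 : ℤ) - (TableauPair.content 2 i 1 : ℤ)) ^ 2) < (n : ℤ)} with hW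
  set NR := Nat.card {i : TableauPair n // 3 * Real.sqrt (n : ℝ) ≤ (i.1.youngDiagram.rowLen 0 : ℝ)}
    with hNR
  set NB := Nat.card {i : TableauPair n //
      (i.1.youngDiagram.rowLen 0 : ℝ) < 3 * Real.sqrt (n : ℝ) ∧
        (i.1.youngDiagram.colLen 0 : ℝ) < 3 * Real.sqrt (n : ℝ) ∧
          (27 : ℝ) / 40 * Real.sqrt (n : ℝ) ≤
            (((Finset.range n).filter (fun j : ℕ => (j, j) ∈ i.1.youngDiagram)).card : ℝ)} with hNB
  have hcount' : (W : ℝ) ≤ 2 * (NR : ℝ) + (NB : ℝ) := by exact_mod_cast hcount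
  refine hcount'.trans ?_
  have hf : (0 : ℝ) ≤ (n.factorial : ℝ) := Nat.cast_nonneg _
  have hsqrt_le : Real.sqrt (n : ℝ) ≤ n := by
    rw [Real.sqrt_le_left (Nat.cast_nonneg n)]
    have h1 : (1 : ℝ) ≤ n := by
      have : ((26 : ℕ) ^ 2 : ℕ) ≤ (n : ℝ) := by exact_mod_cast h26sq
      push_cast at this
      nlinarith
    nlinarith
  have hRn : (NR : ℝ) ≤ (n.factorial : ℝ) * Real.exp (-(c * Real.sqrt (n : ℝ))) := by
    refine (hR n hnR).trans ?_
    gcongr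
    exact min_le_right _ _
  have hBn : (NB : ℝ) ≤ (n.factorial : ℝ) * Real.exp (-(c * Real.sqrt (n : ℝ))) := by
    refine (hB n hnB).trans (mul_le_mul_of_nonneg_left (Real.exp_le_exp.2 ?_) hf)
    have hcle : c ≤ cB := min_le_left _ _
    nlinarith [hsqrt_le, hc, hcle, Real.sqrt_nonneg (n : ℝ)]
  calc 2 * (NR : ℝ) + (NB : ℝ)
      ≤ 2 * ((n.factorial : ℝ) * Real.exp (-(c * Real.sqrt (n : ℝ)))) +
          (n.factorial : ℝ) * Real.exp (-(c * Real.sqrt (n : ℝ))) := by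
        gcongr
    _ = 3 * ((n.factorial : ℝ) * Real.exp (-(c * Real.sqrt (n : ℝ)))) := by ring
    _ ≤ Real.exp (c / 2 * Real.sqrt (n : ℝ)) *
          ((n.factorial : ℝ) * Real.exp (-(c * Real.sqrt (n : ℝ)))) := by
        gcongr
    _ = (n.factorial : ℝ) * Real.exp (-(c / 2 * Real.sqrt (n : ℝ))) := by
        rw [mul_left_comm, ← Real.exp_add]
        congr 1
        ring_nf

end Summit.MatrixMultiplication.MatrixMultiplication.Theorems
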